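import Summits.NavierStokesRegularity.OSWSelfSimilar.SheetNSLineSchochetCornerTorus
import HarnessLib

/-!
# Viscous CLM on the torus (`a = 0`, `σ = 2`): the Fourier cascade is lower-triangular, and LARGE SINE DATA BLOW UP IN
# FINITE TIME — `c ≥ 48ν` ⇒ the coefficients are unbounded at `t = log 2 / ν`

HONEST FRAMING (cell ns-blowup GROUP B «PROFILE SEARCH», zone Z3, row Z3-U addendum A-F2 of `HOME/profile/z3/CENSUS-Z3.md`;
human rulings D-0035/D-0074): **1-D MODEL (viscous Constantin–Lax–Majda equation `ω_t = ω Hω + ν ω_xx` on `𝕋 = ℝ/2πℤ`, the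
`a = 0` member of the viscous gCLM/OSW family); ODE calculus on Fourier-coefficient families, kernel-checked; not Euler, not
Navier–Stokes; «violates: none — MODEL».**

OBJECT (conventions of `SheetNSLineSchochetCornerTorus` / `SheetNSLineTorusCoeffRecursion`). For mean-zero `ω` on `𝕋` the
analytic signal `z := Hω − iω = Σ_{k ≥ 1} c_k(t) e^{ikx}` turns the viscous CLM into `z_t = ½ z² + ν z_xx`, i.e. the Fourier
coefficients (`c_0 ≡ 0`) obey the CASCADE `ċ_k = ½ Σ_{i+j=k} c_i c_j − ν k² c_k` (C), which is LOWER-TRIANGULAR: mode `k` is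
driven only by the modes `< k`. For the sine datum `ω₀ = −c sin x` (`c_1(0) = c ≥ 0`, `c_k(0) = 0` for `k ≥ 2`) every `c_k(t)`
is real `≥ 0` (`nonneg`) and `c_1(t) = c e^{−νt}` (`mode_one`). THE THEOREM is a SUB-SOLUTION comparison with the periodised
Schochet pole profile `m_k(t) = 24ν k (c/(24ν))^k e^{−νkt}` (coefficients `12ν′ k r^k` of `−3ν′ csc²`, `ν′ = 2ν`, receding from
the axis at speed `ν`): by `Σ_{i+j=k} i j = (k³ − k)/6` (`SheetNSLineSchochetCornerTorus.torusCorner_coeff_identity`) the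
mode-`k` Duhamel integral over a window of length `log 2/(ν k(k−1))` reproduces `m_k` with the spare factor `(k+1)/k`
(`lower_step`); the windows telescope to `log 2/ν`, whence `pole_lower_bound`: **for every `k` and `t ≥ log 2/ν`,
`24ν k (c e^{−νt}/(24ν))^k ≤ c_k(t)`**; `lower_bound_at_log_two`: `24ν k (c/(48ν))^k ≤ c_k(log 2/ν)`; `unbounded_of_le`: **if
`48ν ≤ c` the sequence `k ↦ c_k(log 2/ν)` is UNBOUNDED**; `datum_lt_of_bounded` (contrapositive, the census form).

READING (pen; the kernel content is the coefficient calculus): the Fourier coefficients of any solution from `ω₀ = −c sin x`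
that stays in `L¹(𝕋)` (a fortiori in the Wiener algebra, or smooth) on `[0, T]` obey (C) by Duhamel and are bounded by
`sup_t ‖ω(t)‖_{L¹}/π`; hence **`c ≥ 48ν` forces blow-up before `t = log 2/ν`** — finite-time singularity formation for the
PERIODIC problem at `a = 0`, `σ = 2` for all large sine data, the case reported open in print («despite significant effort, we
have been unable to generalize [Schochet's] solution to the periodic domain»
[cite: SilantyevLushnikovSiegelAmbrose2025, §6 p. 25 (arXiv:2411.01891)]; small data are global:
[cite: SilantyevLushnikovSiegelAmbrose2025, Thm 2.2], [cite: AmbroseLushnikovSiegelSilantyev2024, Thm 1 (arXiv:2207.07548)]).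
bears_on: LADDER-NS N5 / zone Z3 (row Z3-U, clause (i′) divide) → N1 linear core. WHAT THIS IS NOT: not NS; no PDE object is
constructed here (the link «solution ⇒ bounded coefficients obeying (C)» is the pen sentence above); `48` is what the one-pole
comparison gives, not the threshold (located numerically near `19.8ν`, `HOME/profile/z3/SHEET.md` §15).
-/

namespace Summit.NavierStokesRegularity.OSWSelfSimilar
namespace SheetNSLineTorusCascade

open Finset Real Set

/-- **The sine-datum cascade.** A family `e : ℕ → ℝ → ℝ` of real mode amplitudes (`e k t` = the coefficient `c_k(t)` of
`e^{ikx}` in `z = Hω − iω`) solving the lower-triangular system (C) on `t > 0`, continuous on `[0, ∞)`, with `e 0 ≡ 0`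
(mean zero), `e 1 0 = c`, `e k 0 = 0` for `k ≥ 2` (datum `ω₀ = −c sin x`). [new here — MODEL] -/
structure IsSineCascade (ν c : ℝ) (e : ℕ → ℝ → ℝ) : Prop where
  /-- mode `0` vanishes identically (mean-zero class) -/
  zero : ∀ t, e 0 t = 0
  /-- every mode is continuous on `[0, ∞)` -/
  cont : ∀ k, ContinuousOn (e k) (Ici 0)
  /-- the cascade (C): `ė_k = ½ Σ_{i+j=k} e_i e_j − ν k² e_k` for `t > 0` -/
  ode : ∀ k : ℕ, ∀ t : ℝ, 0 < t →
    HasDerivAt (e k) ((1 / 2) * (∑ p ∈ antidiagonal k, e p.1 t * e p.2 t) - ν * (k : ℝ) ^ 2 * e k t) t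
  /-- sine datum: `c_1(0) = c` -/
  one_init : e 1 0 = c
  /-- sine datum: `c_k(0) = 0` for `k ≥ 2` -/
  init_zero : ∀ k, 2 ≤ k → e k 0 = 0

variable {ν c : ℝ} {e : ℕ → ℝ → ℝ}

/-- The weighted mode `D_k(t) = e^{νk²t} e_k(t)` has derivative `e^{νk²t}·½ Σ_{i+j=k} e_i e_j` for `t > 0`. [new here — MODEL] -/
theorem hasDerivAt_weighted (he : IsSineCascade ν c e) (k : ℕ) {t : ℝ} (ht : 0 < t) :
    HasDerivAt (fun s => exp (ν * (k : ℝ) ^ 2 * s) * e k s)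
      (exp (ν * (k : ℝ) ^ 2 * t) * ((1 / 2) * ∑ p ∈ antidiagonal k, e p.1 t * e p.2 t)) t := by
  have h1 : HasDerivAt (fun s => exp (ν * (k : ℝ) ^ 2 * s)) (exp (ν * (k : ℝ) ^ 2 * t) * (ν * (k : ℝ) ^ 2)) t := by
    have := ((hasDerivAt_id t).const_mul (ν * (k : ℝ) ^ 2)).exp
    simpa using this
  have h2 := he.ode k t ht
  refine (h1.mul h2).congr_deriv ?_
  ring

/-- Continuity of the weighted mode `e^{νk²t} e_k(t)` on `[0, ∞)`. -/
theorem continuousOn_weighted (he : IsSineCascade ν c e) (k : ℕ) :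
    ContinuousOn (fun s => exp (ν * (k : ℝ) ^ 2 * s) * e k s) (Ici 0) :=
  ((continuous_exp.comp (continuous_const.mul continuous_id)).continuousOn).mul (he.cont k)

/-- **Every mode is nonnegative** for the sine datum with `c ≥ 0` (strong induction on the triangular structure:
`e^{νk²t} e_k` is non-decreasing). [new here — MODEL] -/
theorem nonneg (he : IsSineCascade ν c e) (hc : 0 ≤ c) : ∀ k : ℕ, ∀ t : ℝ, 0 ≤ t → 0 ≤ e k t := by
  intro k
  induction k using Nat.strong_induction_on with
  | _ k ih =>
    intro t ht
    -- `D = e^{νk²s} e_k s` is monotone on `[0, ∞)`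
    have hmono : MonotoneOn (fun s => exp (ν * (k : ℝ) ^ 2 * s) * e k s) (Ici 0) := by
      refine monotoneOn_of_hasDerivWithinAt_nonneg
        (f' := fun s => exp (ν * (k : ℝ) ^ 2 * s) * ((1 / 2) * ∑ p ∈ antidiagonal k, e p.1 s * e p.2 s))
        (convex_Ici 0) (continuousOn_weighted he k) (fun s hs => ?_) (fun s hs => ?_)
      · rw [interior_Ici] at hs ⊢
        exact (hasDerivAt_weighted he k hs).hasDerivWithinAt
      · rw [interior_Ici] at hs
        refine mul_nonneg (exp_pos _).le (mul_nonneg (by norm_num) (sum_nonneg fun p hp => ?_))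
        have hsum : p.1 + p.2 = k := mem_antidiagonal.mp hp
        rcases Nat.eq_zero_or_pos p.1 with h1 | h1
        · rw [h1, he.zero, zero_mul]
        rcases Nat.eq_zero_or_pos p.2 with h2 | h2
        · rw [h2, he.zero, mul_zero]
        exact mul_nonneg (ih p.1 (by omega) s (le_of_lt hs)) (ih p.2 (by omega) s (le_of_lt hs))
    have h0 : 0 ≤ exp (ν * (k : ℝ) ^ 2 * 0) * e k 0 := by
      refine mul_nonneg (exp_pos _).le ?_
      rcases Nat.lt_or_ge k 2 with hk | hk
      · interval_cases k
        · rw [he.zero]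
        · rw [he.one_init]; exact hc
      · rw [he.init_zero k hk]
    have := hmono (self_mem_Ici) ht ht
    have hD : 0 ≤ exp (ν * (k : ℝ) ^ 2 * t) * e k t := le_trans h0 this
    exact (mul_nonneg_iff_of_pos_left (exp_pos _)).mp hD

/-- **Mode 1 is explicit:** `e_1(t) = c e^{−νt}` (the convolution driving mode `1` is `e_0 e_1 + e_1 e_0 = 0`). [new here — MODEL] -/
theorem mode_one (he : IsSineCascade ν c e) : ∀ t : ℝ, 0 ≤ t → e 1 t = c * exp (-(ν * t)) := by
  -- `ψ(s) = e^{νs} e_1(s)` has zero derivative on `(0, ∞)`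
  have hψ : ∀ s : ℝ, 0 < s → HasDerivAt (fun s => exp (ν * ((1 : ℕ) : ℝ) ^ 2 * s) * e 1 s) 0 s := by
    intro s hs
    have h := hasDerivAt_weighted he 1 hs
    have hsum : ∑ p ∈ antidiagonal 1, e p.1 s * e p.2 s = 0 := by
      rw [Nat.sum_antidiagonal_eq_sum_range_succ (fun i j => e i s * e j s) 1]
      simp [sum_range_succ, he.zero]
    simpa [hsum] using h
  have hmono : MonotoneOn (fun s => exp (ν * ((1 : ℕ) : ℝ) ^ 2 * s) * e 1 s) (Ici 0) :=
    monotoneOn_of_hasDerivWithinAt_nonneg (f' := fun _ => 0) (convex_Ici 0) (continuousOn_weighted he 1)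
      (fun s hs => by rw [interior_Ici] at hs ⊢; exact (hψ s hs).hasDerivWithinAt)
      (fun s _ => le_rfl)
  have hanti : AntitoneOn (fun s => exp (ν * ((1 : ℕ) : ℝ) ^ 2 * s) * e 1 s) (Ici 0) :=
    antitoneOn_of_hasDerivWithinAt_nonpos (f' := fun _ => 0) (convex_Ici 0) (continuousOn_weighted he 1)
      (fun s hs => by rw [interior_Ici] at hs ⊢; exact (hψ s hs).hasDerivWithinAt)
      (fun s _ => le_rfl)
  intro t ht
  have h1 := hmono (self_mem_Ici) ht ht
  have h2 := hanti (self_mem_Ici) ht ht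
  have heq : exp (ν * ((1 : ℕ) : ℝ) ^ 2 * t) * e 1 t = exp (ν * ((1 : ℕ) : ℝ) ^ 2 * 0) * e 1 0 :=
    le_antisymm h2 h1
  simp only [Nat.cast_one, one_pow, mul_one, mul_zero, exp_zero, one_mul, he.one_init] at heq
  have hexp : exp (ν * t) * exp (-(ν * t)) = 1 := by rw [← exp_add]; simp
  calc e 1 t = exp (ν * t) * e 1 t * exp (-(ν * t)) := by
          rw [mul_comm (exp (ν * t)), mul_assoc, hexp, mul_one]
    _ = c * exp (-(ν * t)) := by rw [heq]

/-- The comparison profile (periodised Schochet pole with `ν′ = 2ν`, receding at speed `ν`):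
`m_k(t) = 24ν k (c/(24ν))^k e^{−νkt}`. [new here — MODEL] -/
noncomputable def pole (ν c : ℝ) (k : ℕ) (t : ℝ) : ℝ :=
  24 * ν * (k : ℝ) * (c / (24 * ν)) ^ k * exp (-(ν * (k : ℝ) * t))

/-- The pole profile vanishes at mode `0`. -/
theorem pole_zero (ν c t : ℝ) : pole ν c 0 t = 0 := by simp [pole]

/-- The pole profile is nonnegative for `ν, c ≥ 0`. -/
theorem pole_nonneg (hν : 0 ≤ ν) (hc : 0 ≤ c) (k : ℕ) (t : ℝ) : 0 ≤ pole ν c k t := by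
  unfold pole
  have : 0 ≤ c / (24 * ν) := div_nonneg hc (by positivity)
  positivity

/-- At mode `1` the pole profile IS the cascade: `m_1(t) = c e^{−νt}` (for `ν ≠ 0`). -/
theorem pole_one (hν : ν ≠ 0) (c t : ℝ) : pole ν c 1 t = c * exp (-(ν * t)) := by
  unfold pole
  simp only [Nat.cast_one, pow_one, mul_one]
  field_simp

/-- **The convolution of the pole profile**, from `Σ_{i+j=k} i j = (k³−k)/6`
(`SheetNSLineSchochetCornerTorus.torusCorner_coeff_identity` with `ν′ = 2ν`, `r = (c/(24ν)) e^{−νt}`):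
`Σ_{i+j=k} m_i m_j = 96 ν² (k³ − k) (c/(24ν))^k e^{−νkt}`. [new here — MODEL] -/
theorem pole_conv (ν c : ℝ) (k : ℕ) (t : ℝ) :
    ∑ p ∈ antidiagonal k, pole ν c p.1 t * pole ν c p.2 t
      = 96 * ν ^ 2 * ((k : ℝ) ^ 3 - k) * (c / (24 * ν)) ^ k * exp (-(ν * (k : ℝ) * t)) := by
  have key := SheetNSLineSchochetCornerTorus.torusCorner_coeff_identity (2 * ν) (c / (24 * ν) * exp (-(ν * t))) k
  have hrw : ∀ q : ℕ × ℕ, q ∈ antidiagonal k →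
      pole ν c q.1 t * pole ν c q.2 t
        = (12 * (2 * ν) * (q.1 : ℝ) * (c / (24 * ν) * exp (-(ν * t))) ^ q.1)
          * (12 * (2 * ν) * (q.2 : ℝ) * (c / (24 * ν) * exp (-(ν * t))) ^ q.2) := by
    intro q _
    have h1 : exp (-(ν * (q.1 : ℝ) * t)) = exp (-(ν * t)) ^ q.1 := by
      rw [← exp_nat_mul]; congr 1; ring
    have h2 : exp (-(ν * (q.2 : ℝ) * t)) = exp (-(ν * t)) ^ q.2 := by
      rw [← exp_nat_mul]; congr 1; ring
    simp only [pole, mul_pow, h1, h2]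
    ring
  rw [sum_congr rfl hrw]
  have hk : exp (-(ν * (k : ℝ) * t)) = exp (-(ν * t)) ^ k := by
    rw [← exp_nat_mul]; congr 1; ring
  rw [hk]
  have h2 : (12 * (2 * ν) * (k : ℝ) * (c / (24 * ν) * exp (-(ν * t))) ^ k) =
      24 * ν * (k : ℝ) * (c / (24 * ν) * exp (-(ν * t))) ^ k := by ring
  rw [h2, mul_pow] at key
  linarith

/-- **THE WINDOW STEP.** Let `k ≥ 2`, `α ≥ 0`, and suppose every mode `j < k` dominates the pole profile on `[α, ∞)`:
`m_j(s) ≤ e_j(s)`. Then after the window `τ_k = log 2/(ν k (k−1))`, mode `k` dominates it too — indeed with the spare factor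
`(k+1)/k`: for `t ≥ α + τ_k`, `((k+1)/k)·m_k(t) ≤ e_k(t)`. Mechanism: `D_k = e^{νk²s}e_k` has
`D_k′ ≥ e^{νk²s}·½Σ m_i m_j = 48ν²(k³−k)(c/24ν)^k e^{ν(k²−k)s}`, whose integral over the window is `≥ ½` of its value at the
endpoint. [new here — MODEL] -/
theorem lower_step (he : IsSineCascade ν c e) (hν : 0 < ν) (hc : 0 ≤ c) {k : ℕ} (hk : 2 ≤ k) {α : ℝ} (hα : 0 ≤ α)
    (hyp : ∀ j, j < k → ∀ s, α ≤ s → pole ν c j s ≤ e j s) :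
    ∀ t, α + log 2 / (ν * (k : ℝ) * ((k : ℝ) - 1)) ≤ t →
      ((k : ℝ) + 1) / k * pole ν c k t ≤ e k t := by
  intro t ht
  have hk1 : (1 : ℝ) < k := by exact_mod_cast hk
  have hkk : 0 < (k : ℝ) ^ 2 - k := by nlinarith
  have hτpos : 0 < log 2 / (ν * (k : ℝ) * ((k : ℝ) - 1)) := div_pos (log_pos (by norm_num)) (by positivity)
  have hαt : α < t := by linarith
  set q : ℝ := c / (24 * ν) with hq
  have hq0 : 0 ≤ q := div_nonneg hc (by positivity)
  set B : ℝ := 48 * ν * ((k : ℝ) + 1) * q ^ k with hB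
  have hB0 : 0 ≤ B := by positivity
  set G : ℝ → ℝ := fun s => B * exp (ν * ((k : ℝ) ^ 2 - k) * s) with hG
  have hG' : ∀ s, HasDerivAt G (B * (exp (ν * ((k : ℝ) ^ 2 - k) * s) * (ν * ((k : ℝ) ^ 2 - k)))) s := by
    intro s
    have := ((hasDerivAt_id s).const_mul (ν * ((k : ℝ) ^ 2 - k))).exp.const_mul B
    simpa using this
  have hGconv : ∀ s, B * (exp (ν * ((k : ℝ) ^ 2 - k) * s) * (ν * ((k : ℝ) ^ 2 - k)))
      = exp (ν * (k : ℝ) ^ 2 * s) * ((1 / 2) * ∑ p ∈ antidiagonal k, pole ν c p.1 s * pole ν c p.2 s) := by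
    intro s
    rw [pole_conv]
    have hsplit : exp (ν * ((k : ℝ) ^ 2 - k) * s) = exp (ν * (k : ℝ) ^ 2 * s) * exp (-(ν * (k : ℝ) * s)) := by
      rw [← exp_add]; congr 1; ring
    rw [hsplit, hB]
    have h3 : ((k : ℝ) ^ 3 - k) = ((k : ℝ) ^ 2 - k) * ((k : ℝ) + 1) := by ring
    rw [h3]
    ring
  -- termwise domination of the convolution on (α, ∞)
  have hterm : ∀ s, α < s → ∀ p ∈ antidiagonal k, pole ν c p.1 s * pole ν c p.2 s ≤ e p.1 s * e p.2 s := by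
    intro s hs p hp
    have hsum : p.1 + p.2 = k := mem_antidiagonal.mp hp
    rcases Nat.eq_zero_or_pos p.1 with h1 | h1
    · rw [h1, pole_zero, he.zero, zero_mul, zero_mul]
    rcases Nat.eq_zero_or_pos p.2 with h2 | h2
    · rw [h2, pole_zero, he.zero, mul_zero, mul_zero]
    exact mul_le_mul (hyp p.1 (by omega) s hs.le) (hyp p.2 (by omega) s hs.le)
      (pole_nonneg hν.le hc _ _) (le_trans (pole_nonneg hν.le hc _ _) (hyp p.1 (by omega) s hs.le))
  -- φ = D − G is non-decreasing on [α, ∞)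
  set D : ℝ → ℝ := fun s => exp (ν * (k : ℝ) ^ 2 * s) * e k s with hD
  have hφmono : MonotoneOn (fun s => D s - G s) (Ici α) := by
    refine monotoneOn_of_hasDerivWithinAt_nonneg
      (f' := fun s => exp (ν * (k : ℝ) ^ 2 * s) * ((1 / 2) * ∑ p ∈ antidiagonal k, e p.1 s * e p.2 s)
        - B * (exp (ν * ((k : ℝ) ^ 2 - k) * s) * (ν * ((k : ℝ) ^ 2 - k))))
      (convex_Ici α) ?_ (fun s hs => ?_) (fun s hs => ?_)
    · exact ((continuousOn_weighted he k).mono (Ici_subset_Ici.mpr hα)).sub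
        ((continuous_const.mul (continuous_exp.comp (continuous_const.mul continuous_id))).continuousOn)
    · rw [interior_Ici] at hs ⊢
      exact ((hasDerivAt_weighted he k (lt_of_le_of_lt hα hs)).sub (hG' s)).hasDerivWithinAt
    · rw [interior_Ici] at hs
      rw [hGconv s, ← mul_sub, ← mul_sub]
      refine mul_nonneg (exp_pos _).le (mul_nonneg (by norm_num) ?_)
      rw [sub_nonneg]
      exact sum_le_sum (hterm s hs)
  have hDα : 0 ≤ D α := mul_nonneg (exp_pos _).le (nonneg he hc k α hα)
  have hmain : G t - G α ≤ D t := by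
    have := hφmono (self_mem_Ici) (hαt.le : t ∈ Ici α) hαt.le
    simp only at this
    linarith
  have hhalf : G α ≤ (1 / 2) * G t := by
    have hwin : log 2 ≤ ν * ((k : ℝ) ^ 2 - k) * (t - α) := by
      have h1 : log 2 / (ν * (k : ℝ) * ((k : ℝ) - 1)) ≤ t - α := by linarith
      have h2 : ν * (k : ℝ) * ((k : ℝ) - 1) = ν * ((k : ℝ) ^ 2 - k) := by ring
      have hpos : 0 < ν * ((k : ℝ) ^ 2 - k) := by positivity
      rw [h2, div_le_iff₀ hpos] at h1
      linarith
    have hexp : exp (ν * ((k : ℝ) ^ 2 - k) * α) * 2 ≤ exp (ν * ((k : ℝ) ^ 2 - k) * t) := by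
      have : exp (ν * ((k : ℝ) ^ 2 - k) * α) * exp (log 2) ≤
          exp (ν * ((k : ℝ) ^ 2 - k) * α) * exp (ν * ((k : ℝ) ^ 2 - k) * (t - α)) :=
        mul_le_mul_of_nonneg_left (exp_le_exp.mpr hwin) (exp_pos _).le
      rw [exp_log (by norm_num : (0:ℝ) < 2), ← exp_add] at this
      convert this using 2
      ring
    show B * exp (ν * ((k : ℝ) ^ 2 - k) * α) ≤ 1 / 2 * (B * exp (ν * ((k : ℝ) ^ 2 - k) * t))
    have := mul_le_mul_of_nonneg_left hexp hB0
    linarith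
  have hDlow : (1 / 2) * G t ≤ D t := by linarith
  have hid : ((k : ℝ) + 1) / k * pole ν c k t = exp (-(ν * (k : ℝ) ^ 2 * t)) * ((1 / 2) * G t) := by
    show ((k : ℝ) + 1) / k * (24 * ν * (k : ℝ) * (c / (24 * ν)) ^ k * exp (-(ν * (k : ℝ) * t)))
        = exp (-(ν * (k : ℝ) ^ 2 * t)) * ((1 / 2) * (B * exp (ν * ((k : ℝ) ^ 2 - k) * t)))
    have hsplit : exp (-(ν * (k : ℝ) * t)) = exp (-(ν * (k : ℝ) ^ 2 * t)) * exp (ν * ((k : ℝ) ^ 2 - k) * t) := by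
      rw [← exp_add]; congr 1; ring
    rw [hsplit, hB]
    field_simp
    ring
  rw [hid]
  have hsplitD : e k t = exp (-(ν * (k : ℝ) ^ 2 * t)) * D t := by
    show e k t = exp (-(ν * (k : ℝ) ^ 2 * t)) * (exp (ν * (k : ℝ) ^ 2 * t) * e k t)
    rw [← mul_assoc, ← exp_add]; simp
  rw [hsplitD]
  exact mul_le_mul_of_nonneg_left hDlow (exp_pos _).le

/-- The window start times `α_k = (log 2/ν)(1 − 1/k)` (`k ≥ 1`): `α_1 = 0`, `α_k − α_{k−1} = log 2/(ν k(k−1))`, all `< log 2/ν`. -/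
noncomputable def winStart (ν : ℝ) (k : ℕ) : ℝ := log 2 / ν * (1 - 1 / (k : ℝ))

/-- **THE POLE LOWER BOUND (induction over the triangular cascade).** For every `k ≥ 1`: all modes `j ≤ k` dominate the pole
profile from time `α_k` on. [new here — MODEL] -/
theorem pole_le_from_winStart (he : IsSineCascade ν c e) (hν : 0 < ν) (hc : 0 ≤ c) :
    ∀ k : ℕ, 1 ≤ k → ∀ j, j ≤ k → ∀ s, winStart ν k ≤ s → pole ν c j s ≤ e j s := by
  intro k hk
  induction k with
  | zero => exact absurd hk (by norm_num)
  | succ n ih =>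
    rcases Nat.eq_zero_or_pos n with hn | hn
    · -- k = 1: modes 0 and 1
      subst hn
      intro j hj s hs
      have hs0 : 0 ≤ s := by simpa [winStart] using hs
      interval_cases j
      · rw [pole_zero, he.zero]
      · rw [pole_one hν.ne', mode_one he s hs0]
    · -- step n → n+1 with n ≥ 1
      have ih' := ih hn
      have hwn : 0 ≤ winStart ν n := by
        unfold winStart
        have : (1 : ℝ) ≤ n := by exact_mod_cast hn
        have h1 : 0 ≤ 1 - 1 / (n : ℝ) := by
          rw [sub_nonneg, div_le_one (by linarith)]; exact this
        exact mul_nonneg (div_nonneg (log_nonneg (by norm_num)) hν.le) h1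
      have hstep : winStart ν (n + 1) = winStart ν n + log 2 / (ν * ((n + 1 : ℕ) : ℝ) * (((n + 1 : ℕ) : ℝ) - 1)) := by
        have hcast : (((n + 1 : ℕ) : ℝ) - 1) = n := by push_cast; ring
        rw [hcast]
        unfold winStart
        have hn0 : (n : ℝ) ≠ 0 := by exact_mod_cast hn.ne'
        have hn1 : (n : ℝ) + 1 ≠ 0 := by positivity
        have hν0 : ν ≠ 0 := hν.ne'
        push_cast
        field_simp
        ring
      intro j hj s hs
      rcases Nat.lt_or_ge j (n + 1) with hlt | hge
      · -- lower modes: window of n+1 starts later than that of n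
        refine ih' j (by omega) s ?_
        rw [hstep] at hs
        have : 0 ≤ log 2 / (ν * ((n + 1 : ℕ) : ℝ) * (((n + 1 : ℕ) : ℝ) - 1)) := by
          apply div_nonneg (log_nonneg (by norm_num))
          have hn1 : (1 : ℝ) ≤ n := by exact_mod_cast hn
          push_cast
          have : (0:ℝ) ≤ (n:ℝ) + 1 - 1 := by linarith
          positivity
        linarith
      · have hjk : j = n + 1 := le_antisymm hj hge
        subst hjk
        have hmain := lower_step he hν hc (k := n + 1) (by omega) hwn
          (fun i hi s' hs' => ih' i (by omega) s' hs') s (by rw [hstep] at hs; exact hs)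
        refine le_trans ?_ hmain
        have hp : 0 ≤ pole ν c (n + 1) s := pole_nonneg hν.le hc _ _
        have hfac : (1 : ℝ) ≤ (((n + 1 : ℕ) : ℝ) + 1) / ((n + 1 : ℕ) : ℝ) := by
          rw [le_div_iff₀ (by positivity)]; linarith
        nlinarith

/-- **MAIN THEOREM (pole lower bound).** For the sine-datum cascade with `ν > 0`, `c ≥ 0`: for every mode `k` and every
`t ≥ log 2/ν`,   `24ν·k·(c e^{−νt}/(24ν))^k ≤ c_k(t)`  (written with `(c/(24ν))^k e^{−νkt}`). [new here — MODEL] -/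
theorem pole_lower_bound (he : IsSineCascade ν c e) (hν : 0 < ν) (hc : 0 ≤ c) (k : ℕ) (t : ℝ)
    (ht : log 2 / ν ≤ t) :
    24 * ν * (k : ℝ) * (c / (24 * ν)) ^ k * exp (-(ν * (k : ℝ) * t)) ≤ e k t := by
  rcases Nat.eq_zero_or_pos k with hk | hk
  · subst hk; simp [he.zero]
  · have hw : winStart ν k ≤ t := by
      refine le_trans ?_ ht
      unfold winStart
      have h1 : 1 - 1 / (k : ℝ) ≤ 1 := by
        have : (0 : ℝ) ≤ 1 / k := by positivity
        linarith
      have h0 : 0 ≤ log 2 / ν := div_nonneg (log_nonneg (by norm_num)) hν.le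
      nlinarith
    exact pole_le_from_winStart he hν hc k hk k le_rfl t hw

/-- **At `t₁ = log 2/ν`:** `24ν·k·(c/(48ν))^k ≤ c_k(t₁)`. [new here — MODEL] -/
theorem lower_bound_at_log_two (he : IsSineCascade ν c e) (hν : 0 < ν) (hc : 0 ≤ c) (k : ℕ) :
    24 * ν * (k : ℝ) * (c / (48 * ν)) ^ k ≤ e k (log 2 / ν) := by
  have h := pole_lower_bound he hν hc k (log 2 / ν) le_rfl
  have hν0 : ν ≠ 0 := hν.ne'
  have hexp : exp (-(ν * (k : ℝ) * (log 2 / ν))) = (1 / 2) ^ k := by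
    have : -(ν * (k : ℝ) * (log 2 / ν)) = (k : ℝ) * log (1 / 2) := by
      rw [log_div (by norm_num) (by norm_num), log_one]
      field_simp
      ring
    rw [this, exp_nat_mul, exp_log (by norm_num)]
  rw [hexp, mul_assoc, ← mul_pow] at h
  have h48 : c / (48 * ν) = c / (24 * ν) * (1 / 2) := by ring
  rw [h48]
  exact h

/-- **FINITE-TIME BLOW-UP FOR LARGE SINE DATA (coefficient form).** If `c ≥ 48ν` the cascade is unbounded in `k` at the
fixed time `t₁ = log 2/ν` (`c_k(t₁) ≥ 24ν k`): no solution of the viscous CLM on `𝕋` from `ω₀ = −c sin x`, `c ≥ 48ν`, has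
bounded Fourier coefficients at `t₁` — it leaves `L¹(𝕋)` (Wiener algebra, every Sobolev class) before `t₁`. [new here — MODEL] -/
theorem unbounded_of_le (he : IsSineCascade ν c e) (hν : 0 < ν) (hc : 48 * ν ≤ c) :
    ∀ M : ℝ, ∃ k : ℕ, M < e k (log 2 / ν) := by
  intro M
  have hc0 : 0 ≤ c := le_trans (by positivity) hc
  -- choose k with 24 ν k > M
  obtain ⟨k, hk⟩ := exists_nat_gt (M / (24 * ν))
  refine ⟨k, lt_of_lt_of_le ?_ (lower_bound_at_log_two he hν hc0 k)⟩
  have hq : (1 : ℝ) ≤ c / (48 * ν) := by rw [le_div_iff₀ (by positivity)]; linarith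
  have hqk : (1 : ℝ) ≤ (c / (48 * ν)) ^ k := one_le_pow₀ hq
  have h24 : M < 24 * ν * (k : ℝ) := by rw [div_lt_iff₀ (by positivity)] at hk; linarith
  nlinarith [mul_le_mul_of_nonneg_left hqk (by positivity : (0:ℝ) ≤ 24 * ν * (k : ℝ))]

/-- **Contrapositive (the census form).** A sine-datum cascade whose coefficients are bounded at time `log 2/ν` — as are the
Fourier coefficients of any solution that is still in `L¹(𝕋)` at that time — has `c < 48ν`. [new here — MODEL] -/
theorem datum_lt_of_bounded (he : IsSineCascade ν c e) (hν : 0 < ν)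
    (hbdd : ∃ M : ℝ, ∀ k : ℕ, e k (log 2 / ν) ≤ M) : c < 48 * ν := by
  by_contra h
  obtain ⟨M, hM⟩ := hbdd
  obtain ⟨k, hk⟩ := unbounded_of_le he hν (not_lt.mp h) M
  exact absurd (hM k) (not_le.mpr hk)

end SheetNSLineTorusCascade
end Summit.NavierStokesRegularity.OSWSelfSimilar
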